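import Mathlib
import HarnessLib
import Summits.Ventures.LatticeQCDFlow.Exactness.IMHKernel

/-!
# The PSEUDO-MARGINAL flow sampler on a general state space is exact: a positive unbiased ESTIMATE of the weight (stochastic
# fermion determinant, pseudofermions) in the accept/reject step, recycled while the state is kept, samples `π` exactly — and
# the noise can only lower `c₁` and raise `χ²`

HONEST FRAMING: exact (Metropolis-corrected) sampling algorithms for lattice gauge theory;
figures of merit are autocorrelation/cost numbers at stated couplings and volumes; no
continuum-physics claim.

Venture `LatticeQCDFlow` (cell pub-lqcd), topic `Exactness`; FANOUT row 30 (lean-1, GEN-42).  NEW WORK of the cell on a GENERAL measurable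
state space, over Mathlib (`Measure.compProd`, `Measure.setLIntegral_compProd`, `ProbabilityTheory.variance_eq_sub`) and the tree's
`IMHKernel` (`indepMH`, `indepMH_isReversible`, `indepMH_invariant`).  The tree's `Literature/…/PseudoMarginal*.lean` and
`Exactness/NoisyAcceptBias.lean` treat the FINITE state space; the flow proposes on a continuous group and the fermion noise is continuous.
Printed counterparts, named only (nothing is cited as a fact): Beaumont 2003 ∕ Andrieu–Roberts 2009 (the pseudo-marginal method), Lin–Liu–Sloan
2000 (noisy Monte Carlo), the flow-with-pseudofermions samplers of Albergo et al. 2021 and Abbott et al. 2022.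

## Setting
`Ω` (configurations) and `U` (noise: pseudofermion fields, stochastic trace estimators) are measurable spaces; `q` is the flow's output law on
`Ω`; `κ : Kernel Ω U` (Markov) is the noise law used AT configuration `x`; `ŵ : Ω × U → ℝ` is a measurable, pointwise positive ESTIMATE of the
weight, UNBIASED for `w`: `∫ ŵ(x, u) κ_x(du) = w(x)` (hypothesis `hunb`, stated with `∫⁻`/`ofReal`).  The target is `π = w·q`.  The sampler
RUN is: from `(x, u)` propose `y ∼ q` together with FRESH noise `u' ∼ κ_y`, accept with probability `min(1, ŵ(y, u')/ŵ(x, u))`, else keep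
`(x, u)` — the current estimate is recycled, never re-drawn.  This is LITERALLY the tree's independence kernel on the extended space:
`indepMH (q ⊗ₘ κ) ŵ : Kernel (Ω × U) (Ω × U)` (`pseudoMarginal_accept_eq`: the acceptance never evaluates `w`, `q` or the density of `κ`).

## Results (no `sorry`, no new definitions)
* §1 `pseudoMarginal_target_map_fst` — the extended target `π̂ = ŵ·(q ⊗ₘ κ)` has `Ω`-marginal EXACTLY `π = w·q`; `pseudoMarginal_target_apply_fst`,
  `pseudoMarginal_lintegral_comp_fst`, `pseudoMarginal_integral_comp_fst` (every `π`-expectation of a configuration observable is a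
  `π̂`-expectation), `pseudoMarginal_target_univ` (same total mass: `π̂` is a probability law iff `π` is).
* §2 `pseudoMarginal_isReversible`, `pseudoMarginal_invariant` — the run is in detailed balance with `π̂` and leaves it invariant, for EVERY flow,
  EVERY noise law and EVERY positive unbiased estimator; `pseudoMarginal_bind_map_fst`, `pseudoMarginal_iterate_bind_map_fst` — started from `π̂`,
  the configuration after any number of noisy accept/reject steps has law exactly `π`.
* §3 THE PRICE OF NOISE, in the two figures of merit that drive every certified error bar of the tree (`IMHCouplingChiSquare{Rate,Recipe}`):
  `pseudoMarginal_lintegral_min_one_le` — `ĉ₁ = E_{q⊗κ}[min(1, ŵ)] ≤ c₁ = E_q[min(1, w)]` (the burn-in ∕ coupling rate can only get worse);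
  `sq_le_integral_sq_estimate` — `w(x)² ≤ E_κ[ŵ(x, ·)²]` pointwise, with the identity `integral_sq_estimate_eq` `E_κ[ŵ(x, ·)²] = w(x)² + Var_κ ŵ(x, ·)`;
  `pseudoMarginal_lintegral_sq_ge` — `E_{q⊗κ}[ŵ²] ≥ E_q[w²]`, i.e. `1 + χ̂² ≥ 1 + χ²`: the estimator's ESS is at most the exact weight's.
Reading (gauge files with fermions): replacing `det D(U)` by a positive unbiased stochastic estimate inside the flow sampler's accept/reject step
keeps the sampled law EXACTLY `e^{−S_g} det D`-weighted; every certificate of GEN-40/41 applies verbatim on `Ω × U` with `(ĉ₁, χ̂²)`, which are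
never better than `(c₁, χ²)` — noise costs rate, never exactness.  NOT CLAIMED: anything for estimators that can vanish or go negative (sign
problem), any rate beyond the two monotonicities, the `N`-copies law (separate file).
-/

noncomputable section

namespace Summit.Ventures.LatticeQCDFlow.Exactness

open MeasureTheory ProbabilityTheory
open scoped ENNReal

variable {Ω U : Type*} [MeasurableSpace Ω] [MeasurableSpace U]
  {q : Measure Ω} [IsProbabilityMeasure q] {κ : Kernel Ω U} [IsMarkovKernel κ]
  {w : Ω → ℝ} {west : Ω × U → ℝ}

/-! ## §1 The extended target `π̂ = ŵ·(q ⊗ₘ κ)` has `Ω`-marginal `π = w·q` -/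

/-- **THE MARGINAL IDENTITY**: for a positive estimate `ŵ` unbiased for `w` under the noise law `κ`, the push-forward of `π̂ = ŵ·(q ⊗ₘ κ)`
along the configuration coordinate is exactly `π = w·q`. [ours] -/
theorem pseudoMarginal_target_map_fst (hW : Measurable west)
    (hunb : ∀ x, ∫⁻ u, ENNReal.ofReal (west (x, u)) ∂(κ x) = ENNReal.ofReal (w x)) :
    ((q ⊗ₘ κ).withDensity fun z => ENNReal.ofReal (west z)).map Prod.fst = q.withDensity fun x => ENNReal.ofReal (w x) := by
  ext A hA
  rw [Measure.map_apply measurable_fst hA, withDensity_apply _ (measurable_fst hA), withDensity_apply _ hA]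
  have hset : (Prod.fst ⁻¹' A : Set (Ω × U)) = A ×ˢ (Set.univ : Set U) := by
    ext z; simp
  rw [hset, Measure.setLIntegral_compProd hW.ennreal_ofReal hA MeasurableSet.univ]
  refine setLIntegral_congr_fun hA (fun x _ => ?_)
  rw [Measure.restrict_univ, hunb x]

/-- Set-wise form: `π̂(A × U) = π(A)` for every measurable `A`. [ours] -/
theorem pseudoMarginal_target_apply_fst (hW : Measurable west)
    (hunb : ∀ x, ∫⁻ u, ENNReal.ofReal (west (x, u)) ∂(κ x) = ENNReal.ofReal (w x)) {A : Set Ω} (hA : MeasurableSet A) :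
    ((q ⊗ₘ κ).withDensity fun z => ENNReal.ofReal (west z)) (Prod.fst ⁻¹' A) = (q.withDensity fun x => ENNReal.ofReal (w x)) A := by
  rw [← Measure.map_apply measurable_fst hA, pseudoMarginal_target_map_fst hW hunb]

/-- Total mass: `π̂(Ω × U) = π(Ω)` — in particular `π̂` is a probability law exactly when `π` is (normalised weight). [ours] -/
theorem pseudoMarginal_target_univ (hW : Measurable west)
    (hunb : ∀ x, ∫⁻ u, ENNReal.ofReal (west (x, u)) ∂(κ x) = ENNReal.ofReal (w x)) :
    ((q ⊗ₘ κ).withDensity fun z => ENNReal.ofReal (west z)) Set.univ = (q.withDensity fun x => ENNReal.ofReal (w x)) Set.univ := by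
  rw [← Set.preimage_univ (f := (Prod.fst : Ω × U → Ω)), pseudoMarginal_target_apply_fst hW hunb MeasurableSet.univ]

/-- `ℝ≥0∞` observables of the configuration: `∫ g(x) π̂(d(x, u)) = ∫ g dπ`. [ours] -/
theorem pseudoMarginal_lintegral_comp_fst (hW : Measurable west)
    (hunb : ∀ x, ∫⁻ u, ENNReal.ofReal (west (x, u)) ∂(κ x) = ENNReal.ofReal (w x)) {g : Ω → ℝ≥0∞} (hg : Measurable g) :
    ∫⁻ z, g z.1 ∂((q ⊗ₘ κ).withDensity fun z => ENNReal.ofReal (west z)) = ∫⁻ x, g x ∂(q.withDensity fun x => ENNReal.ofReal (w x)) := by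
  rw [← pseudoMarginal_target_map_fst hW hunb, lintegral_map hg measurable_fst]

/-- Real observables of the configuration: `∫ f(x) π̂(d(x, u)) = ∫ f dπ` — every `π`-expectation is a `π̂`-expectation of an observable that
ignores the noise. [ours] -/
theorem pseudoMarginal_integral_comp_fst (hW : Measurable west)
    (hunb : ∀ x, ∫⁻ u, ENNReal.ofReal (west (x, u)) ∂(κ x) = ENNReal.ofReal (w x)) {f : Ω → ℝ}
    (hf : AEStronglyMeasurable f (q.withDensity fun x => ENNReal.ofReal (w x))) :
    ∫ z, f z.1 ∂((q ⊗ₘ κ).withDensity fun z => ENNReal.ofReal (west z)) = ∫ x, f x ∂(q.withDensity fun x => ENNReal.ofReal (w x)) := by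
  rw [← pseudoMarginal_target_map_fst hW hunb] at hf ⊢
  exact (integral_map measurable_fst.aemeasurable hf).symm

/-! ## §2 The run is the independence kernel on `Ω × U`: exact for every flow, noise law and positive unbiased estimator -/

omit [MeasurableSpace Ω] [MeasurableSpace U] in
/-- The acceptance probability AS RUN: `min(1, ŵ(y, u')/ŵ(x, u))` — the estimate at the proposal with its fresh noise against the recycled
estimate of the current state; neither `w`, nor `q`, nor the density of `κ` is evaluated. [ours, bookkeeping] -/
theorem pseudoMarginal_accept_eq (x y : Ω) (u u' : U) :
    imhAccept west (x, u) (y, u') = min 1 (west (y, u') / west (x, u)) := rfl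

/-- **DETAILED BALANCE ON THE EXTENDED SPACE**: the pseudo-marginal flow sampler `indepMH (q ⊗ₘ κ) ŵ` is reversible with respect to
`π̂ = ŵ·(q ⊗ₘ κ)`. [ours — instance of `indepMH_isReversible`] -/
theorem pseudoMarginal_isReversible (hW : Measurable west) (hW0 : ∀ z, 0 < west z) :
    Kernel.IsReversible (indepMH (q ⊗ₘ κ) west) ((q ⊗ₘ κ).withDensity fun z => ENNReal.ofReal (west z)) :=
  indepMH_isReversible hW hW0

/-- **INVARIANCE**: `π̂` is invariant under the pseudo-marginal flow sampler. [ours — instance of `indepMH_invariant`] -/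
theorem pseudoMarginal_invariant (hW : Measurable west) (hW0 : ∀ z, 0 < west z) :
    Kernel.Invariant (indepMH (q ⊗ₘ κ) west) ((q ⊗ₘ κ).withDensity fun z => ENNReal.ofReal (west z)) :=
  indepMH_invariant hW hW0

/-- **EXACTNESS OF THE CONFIGURATION LAW**: from `(X, U) ∼ π̂`, after one noisy accept/reject step the configuration has law EXACTLY `π`.
[ours] -/
theorem pseudoMarginal_bind_map_fst (hW : Measurable west) (hW0 : ∀ z, 0 < west z)
    (hunb : ∀ x, ∫⁻ u, ENNReal.ofReal (west (x, u)) ∂(κ x) = ENNReal.ofReal (w x)) :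
    (((q ⊗ₘ κ).withDensity fun z => ENNReal.ofReal (west z)).bind (indepMH (q ⊗ₘ κ) west)).map Prod.fst =
      q.withDensity fun x => ENNReal.ofReal (w x) := by
  have h : ((q ⊗ₘ κ).withDensity fun z => ENNReal.ofReal (west z)).bind (indepMH (q ⊗ₘ κ) west) =
      (q ⊗ₘ κ).withDensity fun z => ENNReal.ofReal (west z) := pseudoMarginal_invariant hW hW0
  rw [h, pseudoMarginal_target_map_fst hW hunb]

/-- … and after ANY number `t` of steps. [ours] -/
theorem pseudoMarginal_iterate_bind_map_fst (hW : Measurable west) (hW0 : ∀ z, 0 < west z)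
    (hunb : ∀ x, ∫⁻ u, ENNReal.ofReal (west (x, u)) ∂(κ x) = ENNReal.ofReal (w x)) (t : ℕ) :
    ((fun μ : Measure (Ω × U) => μ.bind (indepMH (q ⊗ₘ κ) west))^[t]
        ((q ⊗ₘ κ).withDensity fun z => ENNReal.ofReal (west z))).map Prod.fst = q.withDensity fun x => ENNReal.ofReal (w x) := by
  have h : (fun μ : Measure (Ω × U) => μ.bind (indepMH (q ⊗ₘ κ) west)) ((q ⊗ₘ κ).withDensity fun z => ENNReal.ofReal (west z)) =
      (q ⊗ₘ κ).withDensity fun z => ENNReal.ofReal (west z) := pseudoMarginal_invariant hW hW0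
  rw [Function.iterate_fixed h t, pseudoMarginal_target_map_fst hW hunb]

/-! ## §3 The price of noise: `ĉ₁ ≤ c₁` and `χ̂² ≥ χ²` -/

/-- **THE NOISY `c₁` IS NEVER LARGER**: `E_{q⊗κ}[min(1, ŵ)] ≤ E_q[min(1, w)]` — per configuration, `E_κ[min(1, ŵ(x, ·))] ≤ min(1, E_κ ŵ(x, ·))
= min(1, w(x))`.  (`c₁` sets the every-start burn-in and coupling rates of the tree's certificates.) [ours] -/
theorem pseudoMarginal_lintegral_min_one_le (hW : Measurable west)
    (hunb : ∀ x, ∫⁻ u, ENNReal.ofReal (west (x, u)) ∂(κ x) = ENNReal.ofReal (w x)) :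
    ∫⁻ z, ENNReal.ofReal (min 1 (west z)) ∂(q ⊗ₘ κ) ≤ ∫⁻ x, ENNReal.ofReal (min 1 (w x)) ∂q := by
  rw [Measure.lintegral_compProd (measurable_const.min hW).ennreal_ofReal]
  refine lintegral_mono fun x => ?_
  rw [ENNReal.ofReal_min, ENNReal.ofReal_one]
  refine le_min ?_ ?_
  · calc ∫⁻ u, ENNReal.ofReal (min 1 (west (x, u))) ∂(κ x) ≤ ∫⁻ _, 1 ∂(κ x) :=
          lintegral_mono fun u => by rw [← ENNReal.ofReal_one]; exact ENNReal.ofReal_le_ofReal (min_le_left _ _)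
      _ = 1 := by rw [lintegral_const, measure_univ, mul_one]
  · calc ∫⁻ u, ENNReal.ofReal (min 1 (west (x, u))) ∂(κ x) ≤ ∫⁻ u, ENNReal.ofReal (west (x, u)) ∂(κ x) :=
          lintegral_mono fun u => ENNReal.ofReal_le_ofReal (min_le_right _ _)
      _ = ENNReal.ofReal (w x) := hunb x

/-- **THE SECOND MOMENT OF THE ESTIMATE, PER CONFIGURATION**: `E_κ[ŵ(x, ·)²] = w(x)² + Var_κ ŵ(x, ·)` for a square-integrable estimate unbiased
for `w(x)`. [ours — Mathlib's `variance_eq_sub`] -/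
theorem integral_sq_estimate_eq {x : Ω} (hmem : MemLp (fun u => west (x, u)) 2 (κ x)) (hunb : ∫ u, west (x, u) ∂(κ x) = w x) :
    ∫ u, west (x, u) ^ 2 ∂(κ x) = w x ^ 2 + variance (fun u => west (x, u)) (κ x) := by
  have h := variance_eq_sub hmem
  simp only [Pi.pow_apply] at h
  rw [h, hunb]; ring

/-- Hence `w(x)² ≤ E_κ[ŵ(x, ·)²]` (Jensen for the square). [ours] -/
theorem sq_le_integral_sq_estimate {x : Ω} (hmem : MemLp (fun u => west (x, u)) 2 (κ x)) (hunb : ∫ u, west (x, u) ∂(κ x) = w x) :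
    w x ^ 2 ≤ ∫ u, west (x, u) ^ 2 ∂(κ x) := by
  rw [integral_sq_estimate_eq hmem hunb]
  exact le_add_of_nonneg_right (variance_nonneg _ _)

/-- **THE NOISY `χ²` IS NEVER SMALLER**: `E_q[w²] ≤ E_{q⊗κ}[ŵ²]` (in `ℝ≥0∞`, no global integrability needed), i.e. `1 + χ² ≤ 1 + χ̂²` for
normalised weights — the effective sample size of the noisy weights is at most that of the exact ones. [ours] -/
theorem pseudoMarginal_lintegral_sq_ge (hW : Measurable west) (hmem : ∀ x, MemLp (fun u => west (x, u)) 2 (κ x))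
    (hunb : ∀ x, ∫ u, west (x, u) ∂(κ x) = w x) :
    ∫⁻ x, ENNReal.ofReal (w x ^ 2) ∂q ≤ ∫⁻ z, ENNReal.ofReal (west z ^ 2) ∂(q ⊗ₘ κ) := by
  rw [Measure.lintegral_compProd (hW.pow_const 2).ennreal_ofReal]
  refine lintegral_mono fun x => ?_
  have hint : Integrable (fun u => west (x, u) ^ 2) (κ x) := (hmem x).integrable_sq
  rw [← ofReal_integral_eq_lintegral_ofReal hint (Filter.Eventually.of_forall fun u => sq_nonneg _)]
  exact ENNReal.ofReal_le_ofReal (sq_le_integral_sq_estimate (hmem x) (hunb x))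

omit [IsMarkovKernel κ] in
/-- The two hypotheses forms agree: an integrable nonnegative estimate unbiased in the Bochner sense is unbiased in the `∫⁻` sense used in
§1–§2. [ours, bookkeeping] -/
theorem lintegral_estimate_eq_of_integral_eq (hW0 : ∀ z, 0 < west z) {x : Ω} (hint : Integrable (fun u => west (x, u)) (κ x))
    (hunb : ∫ u, west (x, u) ∂(κ x) = w x) :
    ∫⁻ u, ENNReal.ofReal (west (x, u)) ∂(κ x) = ENNReal.ofReal (w x) := by
  rw [← ofReal_integral_eq_lintegral_ofReal hint (Filter.Eventually.of_forall fun u => (hW0 (x, u)).le), hunb]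

end Summit.Ventures.LatticeQCDFlow.Exactness
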